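import Mathlib
import HarnessLib
import Summits.NavierStokesRegularity.NavierStokesRegularity.Theses.StretchingWellBinding
import Summits.NavierStokesRegularity.NavierStokesRegularity.Theses.HalfHolderEnergy
import Summits.NavierStokesRegularity.NavierStokesRegularity.Theorems.StretchingWellBindingEnstrophyQuarterLawToEnergyHalfHolder
import Summits.NavierStokesRegularity.NavierStokesRegularity.Theorems.StretchingWellBindingEnstrophyQuarterLawSparseness
import Summits.NavierStokesRegularity.NavierStokesRegularity.Theorems.StretchingWellBindingEnstrophyQuarterLawSparsenessEarly

/-!
# Shelf 1574, line `sparse_sieve`: BY NAME — the crux `EnstrophyQuarterLaw` forces uniform sparseness at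
# early times and at fine scales (partial no-loss certificate for stub S2 `UniformSparseness`)

Helper file (`--supports stmt-NavierStokesRegularity-1574 --as helper`). The registered stub S2 of
`Cruxes/EnstrophyQuarterLaw/Lines/sparse_sieve.lean` reads (Cruxes-local predicate `UniformSparseness T u`
unfolded) `∃ r₀ > 0, ∀ ε₀ > 0, ∃ N₀, ∀ t ∈ [0, T), ∀ r ∈ (0, r₀], ∀ F` (`4r`-separated,
`∫_{B(x,2r)} |u(t)|³ ≥ ε₀³` on `F`) `, card F ≤ N₀`. From the crux `EnstrophyQuarterLaw` (1574) — through the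
landed converter `energyHalfHolder_of_enstrophyQuarterLaw` (EQL ⇒ window law) — this file records BY NAME the
two regimes in which the tree now proves that conclusion for every first blow-up:

* `sparse_early_of_enstrophyQuarterLaw` — EARLY times `t ∈ [0, T/2]`, every scale `r > 0`, every threshold
  (`…SparsenessEarly.sparse_early_of_lerayHopf`; in fact no crux is needed there);
* `sparse_fine_of_enstrophyQuarterLaw` — LATE times `t ∈ [T/2, T)` at FINE scales `r ≤ ϑ(ε₀) r₁`
  (`…Sparseness.sparse_fine_of_window`: dissipation quantum + bounded overlap + window law).

RESIDUAL (the part of "`EnstrophyQuarterLaw ⇒ stub_uniformSparseness`" NOT proved in the tree): late times at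
COARSE scales `ϑ(ε₀) r₁ < r ≤ r₀` — near field by volume packing in a fixed ball
(`SparsenessTools.card_filter_mem_ball_le_of_separated`), far field by an exterior `L³` bound for `u(t)`,
`t ∈ [T/2, T)`, from `FarFieldEnstrophy` (p607039) + energy + an exterior div–curl/Sobolev estimate (not in the
tree). HONEST FRAMING: conditional edges between OPEN statements; `EnstrophyQuarterLaw` (1574) and
`UniformSparseness` stay OPEN; nothing here bears on the regularity problem. No summit statement is proved.
-/

noncomputable section

-- the summit-side namespace repeats a component by design (D-0017)
set_option linter.dupNamespace false

namespace Summit.NavierStokesRegularity.NavierStokesRegularity.Theorems.EnstrophyQuarterLaw.SparsenessByName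

open Set MeasureTheory Function Metric Filter Topology
open scoped ENNReal NNReal
open Literature.Analysis.FluidPDE

/-- **`EnstrophyQuarterLaw ⇒` uniform sparseness at EARLY times** (all scales, all thresholds): for every
first blow-up `(u, p)` at `T` from a rapidly decaying Leray–Hopf datum and every `ε₀ > 0` there is `N₀`
bounding every `4r`-separated `ε₀`-concentrating family at every `t ∈ [0, T/2]`, `r > 0`. (The crux
hypothesis is idle here — `sparse_early_of_lerayHopf` needs none; it is carried for the by-name shape.)
[folklore] -/
theorem sparse_early_of_enstrophyQuarterLaw
    (_hQ : Summit.NavierStokesRegularity.NavierStokesRegularity.Theses.StretchingWellBinding.EnstrophyQuarterLaw) :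
    ∀ (ν T : ℝ), 0 < ν → 0 < T →
    ∀ (u : ℝ → EuclideanSpace ℝ (Fin 3) → EuclideanSpace ℝ (Fin 3))
      (p : ℝ → EuclideanSpace ℝ (Fin 3) → ℝ),
    IsMaximalSmoothSolution ν 0 u p T → IsLerayHopfOn T ν 0 (u 0) u → HasRapidSpatialDecay (u 0) →
    ∀ ε₀ : ℝ, 0 < ε₀ → ∃ N₀ : ℕ, ∀ t ∈ Icc 0 (T / 2), ∀ r : ℝ, 0 < r →
      ∀ F : Finset (EuclideanSpace ℝ (Fin 3)),
        (∀ x ∈ F, ∀ y ∈ F, x ≠ y → 4 * r ≤ dist x y) →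
        (∀ x ∈ F, ENNReal.ofReal (ε₀ ^ 3) ≤ ∫⁻ y in ball x (2 * r), ‖u t y‖ₑ ^ 3) →
        F.card ≤ N₀ := by
  intro ν T hν hT u p hmax hLH hdec ε₀ hε₀
  exact SparsenessEarly.sparse_early_of_lerayHopf hν hmax.1 hLH hdec (T' := T / 2)
    ⟨by positivity, by linarith⟩ ε₀ hε₀

/-- **`EnstrophyQuarterLaw ⇒` uniform sparseness at LATE times and FINE scales**: for every first blow-up
`(u, p)` at `T` from a rapidly decaying Leray–Hopf datum there is `r₁ > 0` such that for every `ε₀ > 0`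
there are `N₀` and `ϑ ∈ (0, 1]` bounding every `4r`-separated `ε₀`-concentrating family at every
`t ∈ [T/2, T)` and every `0 < r ≤ ϑ r₁` (EQL ⇒ window law by `energyHalfHolder_of_enstrophyQuarterLaw`, then
`Sparseness.sparse_fine_of_window`). Conditional edge between OPEN statements. [folklore] -/
theorem sparse_fine_of_enstrophyQuarterLaw
    (hQ : Summit.NavierStokesRegularity.NavierStokesRegularity.Theses.StretchingWellBinding.EnstrophyQuarterLaw) :
    ∀ (ν T : ℝ), 0 < ν → 0 < T →
    ∀ (u : ℝ → EuclideanSpace ℝ (Fin 3) → EuclideanSpace ℝ (Fin 3))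
      (p : ℝ → EuclideanSpace ℝ (Fin 3) → ℝ),
    IsMaximalSmoothSolution ν 0 u p T → IsLerayHopfOn T ν 0 (u 0) u → HasRapidSpatialDecay (u 0) →
    ∃ r₁ : ℝ, 0 < r₁ ∧ ∀ ε₀ : ℝ, 0 < ε₀ → ∃ (N₀ : ℕ) (ϑ : ℝ), 0 < ϑ ∧ ϑ ≤ 1 ∧
      ∀ t ∈ Ico (T / 2) T, ∀ r ∈ Ioc 0 (ϑ * r₁), ∀ F : Finset (EuclideanSpace ℝ (Fin 3)),
        (∀ x ∈ F, ∀ y ∈ F, x ≠ y → 4 * r ≤ dist x y) →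
        (∀ x ∈ F, ENNReal.ofReal (ε₀ ^ 3) ≤ ∫⁻ y in ball x (2 * r), ‖u t y‖ₑ ^ 3) →
        F.card ≤ N₀ := by
  intro ν T hν hT u p hmax hLH hdec
  obtain ⟨K, hK⟩ :=
    Summit.NavierStokesRegularity.NavierStokesRegularity.Theorems.energyHalfHolder_of_enstrophyQuarterLaw hQ
      ν T hν hT u p hmax hLH hdec
  -- a non-negative window constant
  have hK' : ∀ a b : ℝ, 0 ≤ a → a ≤ b → b ≤ T →
      ∫⁻ t in Ioo a b, ∫⁻ x, ‖curl (u t) x‖ₑ ^ 2 ≤ ENNReal.ofReal (max K 0 * Real.sqrt (b - a)) :=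
    fun a b ha hab hb => (hK a b ha hab hb).trans (ENNReal.ofReal_le_ofReal
      (mul_le_mul_of_nonneg_right (le_max_left _ _) (Real.sqrt_nonneg _)))
  exact Sparseness.sparse_fine_of_window hν hT hmax.1 hLH (le_max_right K 0) hK'

end Summit.NavierStokesRegularity.NavierStokesRegularity.Theorems.EnstrophyQuarterLaw.SparsenessByName

end
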